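import Literature.Probability.Percolation.SlabRSWGluingCrossings
import HarnessLib

/-!
# Newman–Tassion–Wu 2017, §3.3 — monotonicity of rectangle crossings in the slab

Topic: `Literature/Probability/Percolation`. Two elementary facts about the left-right crossing
event `L ⟷^{[a,b]×[c,d]} R` of a rectangle of the slab `S_k = ℤ² × {0,…,k}` used throughout §3.3
("f_p(n,n) ≥ f_p(n+κn, n)" in the proof of Prop. 3.9; the comparison (3.8) `f(m₁,n₁) ≤ f(m₂,n₂)`
for `m₂ ≤ m₁`, `n₁ ≤ n₂`):

* `slabConn_lr_of_wider` — a left-right crossing of the wider rectangle `[a,b'] × [c,d]`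
  (`b ≤ b'`) contains, up to its first visit of the column `x = b`, a left-right crossing of
  `[a,b] × [c,d]` (lattice configurations);
* `slabConn_mono_domain` — crossings are monotone in the domain;
* `real_lr_wider_le`, `real_lr_le_taller` — the probability comparisons.

## Sources

* C. M. Newman, V. Tassion, W. Wu, *Critical percolation and the minimal spanning tree in slabs*,
  Comm. Pure Appl. Math. 70 (2017), arXiv:1512.09107: §3.3, (3.8) and the proof of
  Proposition 3.9 [NewmanTassionWu2017].
-/

noncomputable section

namespace Literature.Probability.Percolation

open MeasureTheory LatticeModels SimpleGraph

namespace NTW17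

variable {k : ℕ}

/-- **Crossings are monotone in the domain.** [cite: NewmanTassionWu2017, §3.3 ((3.8))] -/
theorem slabConn_mono_domain {B B' X Y : Set (ℤ × ℤ)} (h : B ⊆ B') :
    slabConn k B X Y ⊆ slabConn k B' X Y := by
  rintro ω ⟨x, hx, y, hy, hconn⟩
  exact ⟨x, hx, y, hy, openConnIn_mono (slabLift_mono k h) _ _ hconn⟩

/-- **A left-right crossing of a wider rectangle crosses the narrower one** (lattice
configurations): for `a ≤ b ≤ b'`, an `ω`-open path inside `[a,b'] × [c,d]` from the column
`x = a` to the column `x = b'` contains, up to its first vertex over the column `x = b`, an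
`ω`-open path inside `[a,b] × [c,d]` from `x = a` to `x = b`.
[cite: NewmanTassionWu2017, §3.3 (proof of Proposition 3.9, "f_p(n,n) ≥ f_p(n+κn,n)")] -/
theorem slabConn_lr_of_wider {a b b' c d : ℤ} (hab : a ≤ b) (hbb : b ≤ b') {ω : BondConfig (slab 3 k)}
    (hω : ω ⊆ (slabGraph 3 k).edgeSet)
    (h : ω ∈ slabConn k (boxR a b' c d) {z | z.1 = a} {z | z.1 = b'}) :
    ω ∈ slabConn k (boxR a b c d) {z | z.1 = a} {z | z.1 = b} := by
  obtain ⟨l, hl⟩ := (mem_slabConn_iff_exists_isOSAP ω _ _ _).1 h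
  have hlast : (planar k (l.getLast hl.ne_nil)).1 = b' := by
    have := hl.last_mem hl.ne_nil; rwa [mem_slabLift_iff] at this
  obtain ⟨p₀, v, rest, hleq, hv, hp₀⟩ := exists_first_split (p := fun u => b ≤ (planar k u).1) l
    ⟨l.getLast hl.ne_nil, List.getLast_mem _, by omega⟩
  simp only [not_le] at hp₀
  -- the first vertex over `x ≥ b` lies over `x = b`
  have hvb : (planar k v).1 = b := by
    by_cases hp : p₀ = []
    · subst hp
      have hh := hl.head_mem hl.ne_nil
      simp only [hleq, List.nil_append, List.head_cons, mem_slabLift_iff, Set.mem_setOf_eq] at hh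
      omega
    · have hch := isChain_adj_of_isChain_open hω hl.chain
      rw [hleq] at hch
      have hadj : (slabGraph 3 k).Adj (p₀.getLast hp) v := hch.rel_getLast_head_of_append hp (by simp)
      have h1 := planar_mem_sqBox_one_of_adj hadj
      rw [mem_sqBox_iff'] at h1
      have h2 := hp₀ _ (List.getLast_mem hp)
      push_cast at h1
      omega
  -- the prefix `p₀ ++ [v]`
  have hpre : IsOSAP k ω (slabLift k (boxR a b c d)) (slabLift k {z | z.1 = a}) (slabLift k {z | z.1 = b})
      (p₀ ++ [v]) := by
    refine ⟨?_, ?_, ?_, by simp, ?_, ?_⟩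
    · have := hl.nodup; rw [hleq] at this
      exact this.sublist (by simp)
    · have := hl.chain; rw [hleq] at this
      have e : p₀ ++ v :: rest = (p₀ ++ [v]) ++ rest := by simp
      rw [e] at this
      exact this.left_of_append
    · intro x hx
      rw [mem_slabLift_iff, mem_boxR_iff]
      have hxl : x ∈ l := by
        rw [hleq]
        rcases List.mem_append.1 hx with h | h
        · exact List.mem_append_left _ h
        · rw [List.mem_singleton.1 h]; simp
      have hxS := hl.subset x hxl
      rw [mem_slabLift_iff, mem_boxR_iff] at hxS
      rcases List.mem_append.1 hx with h | h
      · have := hp₀ x h; omega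
      · obtain rfl := List.mem_singleton.1 h; omega
    · intro hne
      have e : (p₀ ++ [v]).head hne = l.head hl.ne_nil := by
        have key : ∀ (m : List (slab 3 k)) (hm : m ≠ []), m = p₀ ++ v :: rest →
            (p₀ ++ [v]).head hne = m.head hm := by
          intro m hm hmeq; subst hmeq; cases p₀ <;> simp
        exact key l hl.ne_nil hleq
      rw [e]; exact hl.head_mem hl.ne_nil
    · intro hne
      rw [List.getLast_append_of_ne_nil _ (by simp), List.getLast_singleton, mem_slabLift_iff]
      exact hvb
  exact (mem_slabConn_iff_exists_isOSAP ω _ _ _).2 ⟨_, hpre⟩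

/-- **`f_p` decreases when the rectangle gets wider**: for `a ≤ b ≤ b'`,
`P_p[L ⟷^{[a,b']×[c,d]} R] ≤ P_p[L ⟷^{[a,b]×[c,d]} R]`.
[cite: NewmanTassionWu2017, §3.3 (proof of Proposition 3.9, "f_p(n,n) ≥ f_p(n+κn,n)"; (3.8))] -/
theorem real_lr_wider_le {a b b' c d : ℤ} (hab : a ≤ b) (hbb : b ≤ b') (p : unitInterval) :
    (bondPercolation (slabGraph 3 k) p).real (slabConn k (boxR a b' c d) {z | z.1 = a} {z | z.1 = b'}) ≤
      (bondPercolation (slabGraph 3 k) p).real (slabConn k (boxR a b c d) {z | z.1 = a} {z | z.1 = b}) := by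
  set P := bondPercolation (slabGraph 3 k) p
  have hae : ∀ᵐ ω ∂P, ω ∈ slabConn k (boxR a b' c d) {z | z.1 = a} {z | z.1 = b'} →
      ω ∈ slabConn k (boxR a b c d) {z | z.1 = a} {z | z.1 = b} := by
    filter_upwards [ae_subset_edgeSet (slabGraph 3 k) p] with ω hω h
    exact slabConn_lr_of_wider hab hbb hω h
  simp only [measureReal_def]
  exact ENNReal.toReal_mono (measure_ne_top _ _) (measure_mono_ae hae)

/-- **`f_p` increases when the rectangle gets taller**: for `[c,d] ⊆ [c',d']`,
`P_p[L ⟷^{[a,b]×[c,d]} R] ≤ P_p[L ⟷^{[a,b]×[c',d']} R]`.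
[cite: NewmanTassionWu2017, §3.3 ((3.8))] -/
theorem real_lr_le_taller {a b c d c' d' : ℤ} (hc : c' ≤ c) (hd : d ≤ d') (p : unitInterval) :
    (bondPercolation (slabGraph 3 k) p).real (slabConn k (boxR a b c d) {z | z.1 = a} {z | z.1 = b}) ≤
      (bondPercolation (slabGraph 3 k) p).real (slabConn k (boxR a b c' d') {z | z.1 = a} {z | z.1 = b}) := by
  refine measureReal_mono (slabConn_mono_domain fun z hz => ?_)
  rw [mem_boxR_iff] at hz ⊢
  omega

end NTW17

end Literature.Probability.Percolation
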